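import Summits.HodgeConjecture.CorCM.MultiFieldWeilFrameTransfer
import Summits.HodgeConjecture.CorCM.Census.SexticOcticDecicWeilDefect
import Summits.HodgeConjecture.CorCM.SexticDecicWeilFrameTransfer
import Summits.HodgeConjecture.CorCM.SexticOcticWeilJointTransitive
import HarnessLib

/-!
# COR-CM — `E × T × B₄ × B₅` over a sextic, an octic and a decic CM field sharing `k`: the three frames as a frame family of the generic model,
# and the REALISED TUPLES — a realised rotation of the five decic pairs and joint transitivity on (sextic pair, octic pair), NO Galois hypothesis

Cell `pub-hodgecm2` (COR-CM), seat b30 gen 28 (2026-08-23); count-neutral own lane, first consumer of the MULTI-FIELD WEIL ENGINE; sequel of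
`Census/SexticOcticDecicWeilDefect.lean` and `CorCM/MultiFieldWeilFrameTransfer.lean`.  Theorems plus four bookkeeping definitions (`e3`, `im3` —
the three frames / three embeddings of `k` as families over `Fin 3` —, `realised3` — their realised tuples —, `decOnly` — the tuple `(1, 1, σ)`); no named fact, no `sorry`.

* §1 `e3`, `im3`, the sign / conjugation / type readings of the family from those of the three frames (`he3_sign`, `he3_conj`, `hΦ3`);
* §2 `decOnly`, `withDc_eq_mul_decOnly`; **`exists_rot_mem_realisedTuples3`**: a conjugate rotation of the five decic pairs, paired with the
  identity on the sextic and octic pairs, is realised — a realised `5`-cycle `σ` exists (Cauchy in the transitive decic part, gen 23ʼs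
  `DecicWeil23Pair.exists_orderFive_mem_realisedPerms`), its realiser induces some `(π₁, π₂, σ)`, and `(π₁, π₂, σ)¹² = (1, 1, σ²)` (`π₁⁶ = 1`,
  `π₂¹² = 1`) with `σ²` again of order `5`; hence **`rot_stable_realisedTuples3`** (the hypothesis `hrot`);
* §3 **`jointTransitive_realisedTuples3`** (the hypothesis `hjt`) from gen 26ʼs counting lemma `SexticOcticWeil.exists_ringEquiv_comp_eq_pair`
  (coprime relative degrees `3`, `4`); §4 **`exists_hasDefectsG_realisedTuples3`** — the hypothesis `hdef` of the generic headline for this instance.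
HONEST FRAMING: nothing about the Hodge conjecture is concluded here; `HC_CM` is not asserted.
[cite: Shimura1998, §18.2 Lemma (i)] [cite: DixonMortimer1996, §2.1] [cite: MoonenZarhin1995Duke, Thm. 2.4]

## References
* [Shimura1998] G. Shimura, *Abelian varieties with CM and modular functions*, §18.2 Lemma (i).  [DixonMortimer1996] J. D. Dixon, B. Mortimer,
  *Permutation Groups*, GTM 163, §2.1.  [MoonenZarhin1995Duke] B. Moonen, Yu. Zarhin, Duke Math. J. 77 (1995), Thm. 2.4.
-/

noncomputable section

open CategoryTheory CategoryTheory.Limits NumberField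

namespace Summit.HodgeConjecture.CorCM.SexticOcticDecicWeil

open Literature.AlgebraicGeometry Literature.AlgebraicGeometry.Motives Literature.AlgebraicGeometry.HodgeTheory
open Literature.NumberTheory.ComplexMultiplication
open Summit.HodgeConjecture.CorCM.Census.MultiFieldWeil
open Summit.HodgeConjecture.CorCM.Census.SexticOcticDecicWeil
open Summit.HodgeConjecture.CorCM.MultiFieldWeil
open Summit.HodgeConjecture.CorCM.SexticOcticWeil (exists_perm_of_comp_tau_eq_fin comp_tau_eq_of_realises_fin exists_ringEquiv_comp_eq_pair)
open Summit.HodgeConjecture.CorCM.SexticDecicWeil (perm_fin_three_pow_six dihPerm_zero_one_eq_finRotate)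
open Summit.HodgeConjecture.CorCM.DecicWeil23Pair (realisedPerms mem_realisedPerms exists_orderFive_mem_realisedPerms exists_conj_rot_of_orderFive)
open Summit.HodgeConjecture.CorCM.OcticCurveFourfold (comp_injective)

open scoped Classical

/-! ## §1 The three frames as a frame family -/

section Frames

variable {I : Type} {Kf : I → Type} [∀ i, Field (Kf i)] {i₀ : I} {is : Fin 3 → I}

variable (is) in
/-- **The frame family** `(e₁; e₂; e₃)` of the generic model (`n3 = (3, 4, 5)`); the slot assignment `is` is explicit (it cannot be
inferred cheaply from the three frames). [folklore] -/
def e3 (e₁ : (Kf (is 0) →+* ℂ) ≃ Fin 3 × Bool) (e₂ : (Kf (is 1) →+* ℂ) ≃ Fin 4 × Bool) (e₃ : (Kf (is 2) →+* ℂ) ≃ Fin 5 × Bool) :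
    ∀ m : Fin 3, (Kf (is m) →+* ℂ) ≃ Fin (n3 m) × Bool := fun m =>
  Fin.cases (motive := fun m => (Kf (is m) →+* ℂ) ≃ Fin (n3 m) × Bool) e₁
    (fun m => Fin.cases (motive := fun m : Fin 2 => (Kf (is m.succ) →+* ℂ) ≃ Fin (n3 m.succ) × Bool) e₂
      (fun m => Fin.cases (motive := fun m : Fin 1 => (Kf (is m.succ.succ) →+* ℂ) ≃ Fin (n3 m.succ.succ) × Bool) e₃
        (fun m => m.elim0) m) m) m

variable (is) in
/-- **The embeddings of `k`** `(i₁; i₂; i₃)` as a family. [folklore] -/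
def im3 (i₁ : Kf i₀ →+* Kf (is 0)) (i₂ : Kf i₀ →+* Kf (is 1)) (i₃ : Kf i₀ →+* Kf (is 2)) : ∀ m : Fin 3, Kf i₀ →+* Kf (is m) := fun m =>
  Fin.cases (motive := fun m => Kf i₀ →+* Kf (is m)) i₁
    (fun m => Fin.cases (motive := fun m : Fin 2 => Kf i₀ →+* Kf (is m.succ)) i₂
      (fun m => Fin.cases (motive := fun m : Fin 1 => Kf i₀ →+* Kf (is m.succ.succ)) i₃ (fun m => m.elim0) m) m) m

variable (e₁ : (Kf (is 0) →+* ℂ) ≃ Fin 3 × Bool) (e₂ : (Kf (is 1) →+* ℂ) ≃ Fin 4 × Bool) (e₃ : (Kf (is 2) →+* ℂ) ≃ Fin 5 × Bool)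
  (i₁ : Kf i₀ →+* Kf (is 0)) (i₂ : Kf i₀ →+* Kf (is 1)) (i₃ : Kf i₀ →+* Kf (is 2))

/-- `e3 0 = e₁`. [folklore] -/
@[simp] theorem e3_zero : e3 is e₁ e₂ e₃ 0 = e₁ := rfl
/-- `e3 1 = e₂`. [folklore] -/
@[simp] theorem e3_one : e3 is e₁ e₂ e₃ 1 = e₂ := rfl
/-- `e3 2 = e₃`. [folklore] -/
@[simp] theorem e3_two : e3 is e₁ e₂ e₃ 2 = e₃ := rfl
/-- `im3 0 = i₁`. [folklore] -/
@[simp] theorem im3_zero : im3 is i₁ i₂ i₃ 0 = i₁ := rfl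
/-- `im3 1 = i₂`. [folklore] -/
@[simp] theorem im3_one : im3 is i₁ i₂ i₃ 1 = i₂ := rfl
/-- `im3 2 = i₃`. [folklore] -/
@[simp] theorem im3_two : im3 is i₁ i₂ i₃ 2 = i₃ := rfl

variable (is) in
/-- **The realised tuples of the three frames** (the generic `realisedTuples` with the slot data made explicit). [folklore] -/
def realised3 (τ : Kf i₀ →+* ℂ) : Finset (PermsG n3) := realisedTuples (is := is) (n := n3) (e3 is e₁ e₂ e₃) τ

/-- Unfolding of `realised3`. [folklore] -/
theorem realised3_eq (τ : Kf i₀ →+* ℂ) : realised3 is e₁ e₂ e₃ τ = realisedTuples (is := is) (n := n3) (e3 is e₁ e₂ e₃) τ := rfl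

variable {e₁ e₂ e₃ i₁ i₂ i₃} {τ : Kf i₀ →+* ℂ}

/-- The sign readings of the family from those of the three frames. [folklore] -/
theorem he3_sign (he₁_sign : ∀ s, (e₁ s).2 = true ↔ s.comp i₁ = τ) (he₂_sign : ∀ s, (e₂ s).2 = true ↔ s.comp i₂ = τ)
    (he₃_sign : ∀ s, (e₃ s).2 = true ↔ s.comp i₃ = τ) :
    ∀ (m : Fin 3) (s : Kf (is m) →+* ℂ), (e3 is e₁ e₂ e₃ m s).2 = true ↔ s.comp (im3 is i₁ i₂ i₃ m) = τ := fun m =>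
  Fin.cases (motive := fun m => ∀ s : Kf (is m) →+* ℂ, (e3 is e₁ e₂ e₃ m s).2 = true ↔ s.comp (im3 is i₁ i₂ i₃ m) = τ) he₁_sign
    (fun m => Fin.cases (motive := fun m : Fin 2 => ∀ s : Kf (is m.succ) →+* ℂ,
        (e3 is e₁ e₂ e₃ m.succ s).2 = true ↔ s.comp (im3 is i₁ i₂ i₃ m.succ) = τ) he₂_sign
      (fun m => Fin.cases (motive := fun m : Fin 1 => ∀ s : Kf (is m.succ.succ) →+* ℂ,
          (e3 is e₁ e₂ e₃ m.succ.succ s).2 = true ↔ s.comp (im3 is i₁ i₂ i₃ m.succ.succ) = τ) he₃_sign (fun m => m.elim0) m) m) m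

/-- The conjugation readings of the family from those of the three frames. [folklore] -/
theorem he3_conj (he₁_conj : ∀ s, e₁ (ComplexEmbedding.conjugate s) = ((e₁ s).1, !(e₁ s).2))
    (he₂_conj : ∀ s, e₂ (ComplexEmbedding.conjugate s) = ((e₂ s).1, !(e₂ s).2))
    (he₃_conj : ∀ s, e₃ (ComplexEmbedding.conjugate s) = ((e₃ s).1, !(e₃ s).2)) :
    ∀ (m : Fin 3) (s : Kf (is m) →+* ℂ), e3 is e₁ e₂ e₃ m (ComplexEmbedding.conjugate s) = ((e3 is e₁ e₂ e₃ m s).1, !(e3 is e₁ e₂ e₃ m s).2) := fun m =>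
  Fin.cases (motive := fun m => ∀ s : Kf (is m) →+* ℂ,
      e3 is e₁ e₂ e₃ m (ComplexEmbedding.conjugate s) = ((e3 is e₁ e₂ e₃ m s).1, !(e3 is e₁ e₂ e₃ m s).2)) he₁_conj
    (fun m => Fin.cases (motive := fun m : Fin 2 => ∀ s : Kf (is m.succ) →+* ℂ,
        e3 is e₁ e₂ e₃ m.succ (ComplexEmbedding.conjugate s) = ((e3 is e₁ e₂ e₃ m.succ s).1, !(e3 is e₁ e₂ e₃ m.succ s).2)) he₂_conj
      (fun m => Fin.cases (motive := fun m : Fin 1 => ∀ s : Kf (is m.succ.succ) →+* ℂ,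
          e3 is e₁ e₂ e₃ m.succ.succ (ComplexEmbedding.conjugate s) = ((e3 is e₁ e₂ e₃ m.succ.succ s).1, !(e3 is e₁ e₂ e₃ m.succ.succ s).2))
        he₃_conj (fun m => m.elim0) m) m) m

variable {Φ : ∀ j : Fin (3 + 1), CMType (Kf (mfSlots i₀ is j))}

/-- The type readings of the family at the position sets `P3 = ({0}, {0}, {0,1})` from the three one-line readings. [folklore] -/
theorem hΦ3 (hΦ₁ : ∀ s : Kf (is 0) →+* ℂ, s ∈ (Φ 1).1 ↔ (e₁ s).2 = decide ((e₁ s).1 = 0))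
    (hΦ₂ : ∀ s : Kf (is 1) →+* ℂ, s ∈ (Φ 2).1 ↔ (e₂ s).2 = decide ((e₂ s).1 = 0))
    (hΦ₃ : ∀ s : Kf (is 2) →+* ℂ, s ∈ (Φ 3).1 ↔ (e₃ s).2 = decide ((e₃ s).1 = 0 ∨ (e₃ s).1 = 1)) :
    ∀ (m : Fin 3) (s : Kf (is m) →+* ℂ), s ∈ (Φ m.succ).1 ↔ (e3 is e₁ e₂ e₃ m s).2 = decide ((e3 is e₁ e₂ e₃ m s).1 ∈ P3 m) := by
  have h0 : ∀ s : Kf (is 0) →+* ℂ, s ∈ (Φ 1).1 ↔ (e3 is e₁ e₂ e₃ 0 s).2 = decide ((e3 is e₁ e₂ e₃ 0 s).1 ∈ P3 0) := fun s => by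
    refine (hΦ₁ s).trans ?_
    show (e₁ s).2 = decide ((e₁ s).1 = 0) ↔ (e₁ s).2 = decide ((e₁ s).1 ∈ lowPos 3 1)
    have hd : decide ((e₁ s).1 ∈ lowPos 3 1) = decide ((e₁ s).1 = 0) := decide_eq_decide.2 mem_lowPos_one
    rw [hd]
  have h1 : ∀ s : Kf (is 1) →+* ℂ, s ∈ (Φ 2).1 ↔ (e3 is e₁ e₂ e₃ 1 s).2 = decide ((e3 is e₁ e₂ e₃ 1 s).1 ∈ P3 1) := fun s => by
    refine (hΦ₂ s).trans ?_
    show (e₂ s).2 = decide ((e₂ s).1 = 0) ↔ (e₂ s).2 = decide ((e₂ s).1 ∈ lowPos 4 1)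
    have hd : decide ((e₂ s).1 ∈ lowPos 4 1) = decide ((e₂ s).1 = 0) := decide_eq_decide.2 mem_lowPos_one
    rw [hd]
  have h2 : ∀ s : Kf (is 2) →+* ℂ, s ∈ (Φ 3).1 ↔ (e3 is e₁ e₂ e₃ 2 s).2 = decide ((e3 is e₁ e₂ e₃ 2 s).1 ∈ P3 2) := fun s => by
    refine (hΦ₃ s).trans ?_
    show (e₃ s).2 = decide ((e₃ s).1 = 0 ∨ (e₃ s).1 = 1) ↔ (e₃ s).2 = decide ((e₃ s).1 ∈ lowPos 5 2)
    have hd : decide ((e₃ s).1 ∈ lowPos 5 2) = decide ((e₃ s).1 = 0 ∨ (e₃ s).1 = 1) := decide_eq_decide.2 mem_lowPos_two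
    rw [hd]
  intro m
  exact Fin.cases (motive := fun m => ∀ s : Kf (is m) →+* ℂ, s ∈ (Φ m.succ).1 ↔ (e3 is e₁ e₂ e₃ m s).2 = decide ((e3 is e₁ e₂ e₃ m s).1 ∈ P3 m))
    h0 (fun m => Fin.cases (motive := fun m : Fin 2 => ∀ s : Kf (is m.succ) →+* ℂ,
      s ∈ (Φ m.succ.succ).1 ↔ (e3 is e₁ e₂ e₃ m.succ s).2 = decide ((e3 is e₁ e₂ e₃ m.succ s).1 ∈ P3 m.succ)) h1
      (fun m => Fin.cases (motive := fun m : Fin 1 => ∀ s : Kf (is m.succ.succ) →+* ℂ,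
        s ∈ (Φ m.succ.succ.succ).1 ↔ (e3 is e₁ e₂ e₃ m.succ.succ s).2 = decide ((e3 is e₁ e₂ e₃ m.succ.succ s).1 ∈ P3 m.succ.succ)) h2
        (fun m => m.elim0) m) m) m

end Frames

/-! ## §2 A realised rotation of the five decic pairs, identity on the sextic and octic pairs -/

section Realised

variable {I : Type} {Kf : I → Type} [∀ i, Field (Kf i)] [∀ i, NumberField (Kf i)] {i₀ : I} {is : Fin 3 → I}
  {e₁ : (Kf (is 0) →+* ℂ) ≃ Fin 3 × Bool} {e₂ : (Kf (is 1) →+* ℂ) ≃ Fin 4 × Bool} {e₃ : (Kf (is 2) →+* ℂ) ≃ Fin 5 × Bool}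
  {i₁ : Kf i₀ →+* Kf (is 0)} {i₂ : Kf i₀ →+* Kf (is 1)} {i₃ : Kf i₀ →+* Kf (is 2)} {τ : Kf i₀ →+* ℂ}
  (he₁_sign : ∀ s, (e₁ s).2 = true ↔ s.comp i₁ = τ) (he₂_sign : ∀ s, (e₂ s).2 = true ↔ s.comp i₂ = τ)
  (he₃_sign : ∀ s, (e₃ s).2 = true ↔ s.comp i₃ = τ)

omit [∀ i, NumberField (Kf i)] in
/-- Every permutation of four letters has order dividing `12`. [folklore] -/
theorem perm_fin_four_pow_twelve : ∀ π : Equiv.Perm (Fin 4), π ^ 12 = 1 := by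
  decide +kernel

/-- **The tuple `(1, 1, σ)`.** [folklore] -/
def decOnly (σ : Equiv.Perm (Fin 5)) : PermsG n3 := withDc 1 σ

omit [∀ i, NumberField (Kf i)] in
/-- **Right translation of the decic component is right multiplication by `(1, 1, σ)`.** [folklore] -/
theorem withDc_eq_mul_decOnly (π : PermsG n3) (σ : Equiv.Perm (Fin 5)) : withDc π (dc π * σ) = π * decOnly σ := by
  funext m
  refine Fin.cases ?_ (fun m => Fin.cases ?_ (fun m => Fin.cases ?_ (fun m => m.elim0) m) m) m
  · show sx (withDc π (dc π * σ)) = sx π * sx (withDc 1 σ)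
    rw [sx_withDc, sx_withDc]; exact (mul_one _).symm
  · show oc (withDc π (dc π * σ)) = oc π * oc (withDc 1 σ)
    rw [oc_withDc, oc_withDc]; exact (mul_one _).symm
  · show dc (withDc π (dc π * σ)) = dc π * dc (withDc 1 σ)
    rw [dc_withDc, dc_withDc]

include he₁_sign he₂_sign he₃_sign in
/-- **A conjugate rotation of the five decic pairs, paired with the identity on the sextic and octic pairs, is realised** (NO Galois hypothesis).
A realised `5`-cycle `σ` exists (Cauchy in the transitive group of realised permutations of the five pairs — gen 23); its realiser fixes `τ` and
induces some tuple `(π₁, π₂, σ)`; the 12th power of that tuple is `(1, 1, σ²)` and `σ²` has order `5` again, so it is a conjugate of the rotation.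
[cite: Shimura1998, §18.2 Lemma (i)] [cite: DixonMortimer1996, §2.1] -/
theorem exists_rot_mem_realisedTuples3 :
    ∃ g : Equiv.Perm (Fin 5), decOnly (g * finRotate 5 * g⁻¹) ∈ realised3 is e₁ e₂ e₃ τ := by
  obtain ⟨σ, hσ, h5, h1⟩ := exists_orderFive_mem_realisedPerms (e := e₃) he₃_sign
  obtain ⟨ρ, hρ₃⟩ := (mem_realisedPerms e₃ σ).1 hσ
  have hρτ : (ρ : ℂ →+* ℂ).comp τ = τ := comp_tau_eq_of_realises_fin he₃_sign ρ hρ₃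
  obtain ⟨π, hπ, hπρ⟩ := exists_mem_realisedTuples_of_comp_tau_eq (is := is) (n := n3) (e := e3 is e₁ e₂ e₃) (he3_sign (is := is) he₁_sign he₂_sign he₃_sign) ρ hρτ
  -- the decic component of `π` is `σ`
  have hdc : dc π = σ := by
    ext b : 1
    have h := hπρ 2 b
    have h' : (ρ : ℂ →+* ℂ).comp (e₃.symm (b, true)) = e₃.symm (dc π b, true) := h
    rw [hρ₃ b] at h'
    exact ((Prod.mk.inj (e₃.symm.injective h')).1).symm
  -- the 12th power of the tuple is `(1, 1, σ²)`
  have hσ10 : σ ^ 10 = 1 := (pow_mul σ 5 2).trans (by rw [h5, one_pow])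
  have hpow : π ^ (11 + 1) = decOnly (σ ^ 2) := by
    funext m
    refine Fin.cases ?_ (fun m => Fin.cases ?_ (fun m => Fin.cases ?_ (fun m => m.elim0) m) m) m
    · have h' : sx π ^ 12 = sx (withDc 1 (σ ^ 2)) := by
        rw [sx_withDc]
        exact (pow_mul (sx π) 6 2).trans (by rw [perm_fin_three_pow_six, one_pow]; rfl)
      exact h'
    · have h' : oc π ^ 12 = oc (withDc 1 (σ ^ 2)) := by
        rw [oc_withDc, perm_fin_four_pow_twelve]; rfl
      exact h'
    · have h' : dc π ^ 12 = dc (withDc 1 (σ ^ 2)) := by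
        rw [dc_withDc, hdc]
        exact (pow_add σ 10 2).trans (by rw [hσ10, one_mul])
      exact h'
  -- `σ²` has order `5`
  have h5' : (σ ^ 2) ^ 5 = 1 := (pow_mul σ 2 5).symm.trans hσ10
  have h6 : σ ^ 6 = σ := (pow_succ σ 5).trans (by rw [h5, one_mul])
  have h1' : σ ^ 2 ≠ 1 := fun h => h1 (by
    have h' : σ ^ 6 = 1 := (pow_mul σ 2 3).trans (by rw [h, one_pow])
    rw [h6] at h'
    exact h')
  obtain ⟨g, hg⟩ := exists_conj_rot_of_orderFive (σ ^ 2) h5' h1'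
  refine ⟨g, ?_⟩
  rw [← dihPerm_zero_one_eq_finRotate, hg, ← hpow]
  exact pow_mem_realisedTuples (is := is) (n := n3) (e3 is e₁ e₂ e₃) τ hπ 11

include he₁_sign he₂_sign he₃_sign in
/-- **The realised tuples are stable under right translation of the decic component by a realised conjugate rotation** — the hypothesis `hrot` of
the defect law. [cite: DixonMortimer1996, §2.1] -/
theorem rot_stable_realisedTuples3 : ∃ g : Equiv.Perm (Fin 5),
    ∀ π ∈ realised3 is e₁ e₂ e₃ τ, withDc π (dc π * (g * finRotate 5 * g⁻¹)) ∈ realised3 is e₁ e₂ e₃ τ := by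
  obtain ⟨g, hg⟩ := exists_rot_mem_realisedTuples3 he₁_sign he₂_sign he₃_sign
  refine ⟨g, fun π hπ => ?_⟩
  rw [withDc_eq_mul_decOnly]
  exact mul_mem_realisedTuples (is := is) (n := n3) (e3 is e₁ e₂ e₃) τ hπ hg

/-! ## §3 Joint transitivity on (sextic pair, octic pair) -/

include he₁_sign he₂_sign he₃_sign in
/-- **Every (sextic pair, octic pair) is moved to `(0, 0)` by a realised tuple** — the hypothesis `hjt` of the defect law — from JOINT TRANSITIVITY of
`Aut(ℂ/k)` on `Fib₁ × Fib₂` for the coprime relative degrees `3`, `4` (gen 26ʼs `SexticOcticWeil.exists_ringEquiv_comp_eq_pair`), NO Galois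
hypothesis. [cite: DixonMortimer1996, §2.1] [cite: Shimura1998, §18.2 Lemma (i)] -/
theorem jointTransitive_realisedTuples3 (h2 : Module.finrank ℚ (Kf i₀) = 2) (h6 : Module.finrank ℚ (Kf (is 0)) = 6)
    (h8 : Module.finrank ℚ (Kf (is 1)) = 8) :
    ∀ (x : Fin 3) (y : Fin 4), ∃ π ∈ realised3 is e₁ e₂ e₃ τ, sx π x = 0 ∧ oc π y = 0 := by
  intro x y
  have hx : (e₁.symm (x, true)).comp i₁ = τ := (he₁_sign _).1 (by rw [Equiv.apply_symm_apply])
  have hx' : (e₁.symm ((0 : Fin 3), true)).comp i₁ = τ := (he₁_sign _).1 (by rw [Equiv.apply_symm_apply])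
  have hy : (e₂.symm (y, true)).comp i₂ = τ := (he₂_sign _).1 (by rw [Equiv.apply_symm_apply])
  have hy' : (e₂.symm ((0 : Fin 4), true)).comp i₂ = τ := (he₂_sign _).1 (by rw [Equiv.apply_symm_apply])
  obtain ⟨ρ, hρx, hρy⟩ := exists_ringEquiv_comp_eq_pair h2 h6 h8 i₁ i₂ _ _ _ _ hx hx' hy hy'
  have hρτ : (ρ : ℂ →+* ℂ).comp τ = τ := by
    calc (ρ : ℂ →+* ℂ).comp τ = ((ρ : ℂ →+* ℂ).comp (e₁.symm (x, true))).comp i₁ := by rw [RingHom.comp_assoc, hx]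
      _ = τ := by rw [hρx, hx']
  obtain ⟨π, hπ, hπρ⟩ := exists_mem_realisedTuples_of_comp_tau_eq (is := is) (n := n3) (e := e3 is e₁ e₂ e₃) (he3_sign (is := is) he₁_sign he₂_sign he₃_sign) ρ hρτ
  refine ⟨π, hπ, ?_, ?_⟩
  · have h := hπρ 0 x
    change (ρ : ℂ →+* ℂ).comp (e₁.symm (x, true)) = e₁.symm (sx π x, true) at h
    rw [hρx] at h
    exact ((Prod.mk.inj (e₁.symm.injective h)).1).symm
  · have h := hπρ 1 y
    change (ρ : ℂ →+* ℂ).comp (e₂.symm (y, true)) = e₂.symm (oc π y, true) at h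
    rw [hρy] at h
    exact ((Prod.mk.inj (e₂.symm.injective h)).1).symm

/-! ## §4 The defect law for the realised tuples -/

include he₁_sign he₂_sign he₃_sign in
/-- **Every configuration balanced under the realised tuples of a sextic, an octic and a decic CM field through `k` obeys the defect law with curve
multiplicities `(1, 2, 1)`** — the hypothesis `hdef` of `MultiFieldWeil.hodgeConjectureFor_biproduct_comp_of_defectLawG`, NO Galois hypothesis.
[cite: MoonenZarhin1995Duke, Thm. 2.4] [cite: DixonMortimer1996, §2.1] -/
theorem exists_hasDefectsG_realisedTuples3 (h2 : Module.finrank ℚ (Kf i₀) = 2) (h6 : Module.finrank ℚ (Kf (is 0)) = 6)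
    (h8 : Module.finrank ℚ (Kf (is 1)) = 8) {α : Type} (v : α → PtG n3) (T : Finset α)
    (hT : ModelBalancedG P3 (realised3 is e₁ e₂ e₃ τ) v T) : ∃ t : Fin 3 → ℤ, HasDefectsG c3 v T t := by
  obtain ⟨g, hrot⟩ := rot_stable_realisedTuples3 he₁_sign he₂_sign he₃_sign
  exact exists_hasDefectsG_of_modelBalancedG3 g hrot (jointTransitive_realisedTuples3 he₁_sign he₂_sign he₃_sign h2 h6 h8) hT

end Realised

end Summit.HodgeConjecture.CorCM.SexticOcticDecicWeil

end
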